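import Literature.MathematicalPhysics.KineticTheory.PureQuarticKernel
import Literature.MathematicalPhysics.KineticTheory.PureQuarticChainConfined
import HarnessLib

/-!
# The two transition kernels of the purely quartic chain agree

Topic `Literature/MathematicalPhysics/KineticTheory`. Glue for the proof of the named fact
`CuneoEckmannHairerReyBellet2018_thm213_pureQuartic` (`PureQuarticChainNESS.lean`; CEHR 2018,
Thm 2.13, for `pureQuarticChain μ γ = ⟨μq⁴/4, r⁴/4, γ⟩`, `μ > 0`, `γ ≥ 0`). The purely quartic chain
now sits on TWO pipelines: the chain pipeline (`OscillatorChain.transitionKernel`, law of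
`chainFlow` driven by `chainNoise`, `PureQuarticKernel.lean` — carrying the Lyapunov condition H2
and Harris' theorem re-instantiated from the pinned chain) and the model-free pipeline
(`OscillatorChain.langevinKernel`, law of `drivenFlow` driven by `pairNoise`,
`LangevinChainConfined.lean` / `PureQuarticChainConfined.lean` — carrying LaSalle, the pointed
irreducibility and the time-reversal / density theory). This file shows they are the SAME kernels
(the two pathwise flows are literally the same Picard limit, driven by the same regularised bath
noise), so results proved on either side transfer:

* `pureQuarticChain_pairNoise_eq` — `pairNoise v_L v_R w = (0, chainNoise N c_L c_R w)`;
* `pureQuarticChain_langevinSolMap_eq_solMap` — the solution maps agree (definitionally, once the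
  noise paths are identified);
* `pureQuarticChain_langevinKernel_eq_transitionKernel` — the kernels agree;
* `pureQuarticChain_lintegral_exp_mul_hamiltonian_transitionKernel_le` — CEHR (3.4) for
  `transitionKernel`, transported from `PureQuarticChainConfined.lean`.

[folklore]
-/

noncomputable section

open MeasureTheory ProbabilityTheory Filter Topology Set Metric
open scoped NNReal ENNReal

namespace Literature.MathematicalPhysics.KineticTheory.HeatConduction

open Literature.Probability.Process Literature.MathematicalPhysics.KineticTheory OscillatorChain

variable {N : ℕ}

section Kernels

variable {μ γ : ℝ} (hμ : 0 < μ) (hγ : 0 ≤ γ) (N : ℕ) (T_L T_R : ℝ)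

/-- The bath-noise path of the model-free pipeline is the momentum-noise path of the chain
pipeline: `pairNoise v_L v_R w t = (0, chainNoise N c_L c_R w t)`. [folklore] -/
theorem pureQuarticChain_pairNoise_eq (w : WienerPair) :
    pairNoise ((pureQuarticChain μ γ).bathVecL N T_L) ((pureQuarticChain μ γ).bathVecR N T_R) w =
      fun t => (((0 : Fin N → ℝ),
        chainNoise N (Real.sqrt (2 * γ * T_L)) (Real.sqrt (2 * γ * T_R)) w t) : PhaseSpace N) := by
  funext t
  simp only [pairNoise, OscillatorChain.bathVecL, OscillatorChain.bathVecR, bathVec,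
    pureQuarticChain_γ]
  ext i
  · simp
  · simp only [Prod.snd_add, Prod.smul_snd, Pi.add_apply, Pi.smul_apply, smul_eq_mul, chainNoise]
    ring

/-- **The two solution maps agree**: the model-free `langevinSolMap` (`drivenFlow` of the drift
driven by `pairNoise`) IS the chain pipeline's `solMap` (`chainFlow` driven by `chainNoise`) — both
are the same Picard limit. [folklore] -/
theorem pureQuarticChain_langevinSolMap_eq_solMap :
    (pureQuarticChain μ γ).langevinSolMap N T_L T_R = (pureQuarticChain μ γ).solMap N T_L T_R := by
  funext t x w
  unfold OscillatorChain.langevinSolMap sdeSolMap OscillatorChain.solMap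
  rw [pureQuarticChain_pairNoise_eq]
  rfl

include hμ hγ in
/-- **The two transition kernels of the purely quartic chain agree** (`μ > 0`, `γ ≥ 0`):
`langevinKernel` (model-free pipeline) `=` `transitionKernel` (chain pipeline) — both are the law of
the same solution map under the Wiener pair. [folklore] -/
theorem pureQuarticChain_langevinKernel_eq_transitionKernel (t : ℝ≥0) :
    (pureQuarticChain μ γ).langevinKernel N T_L T_R t =
      (pureQuarticChain μ γ).transitionKernel N T_L T_R t := by
  refine Kernel.ext fun x => ?_
  rw [(pureQuarticChain_isConfining hμ hγ).langevinKernel_apply N T_L T_R t x,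
    pureQuarticChain_transitionKernel_apply hμ hγ N T_L T_R t x,
    pureQuarticChain_langevinSolMap_eq_solMap N T_L T_R]

/-- The kernels of `pureQuarticSemigroup`'s model-free twin `IsConfining.semigroup` are the chain
pipeline's transition kernels. [folklore] -/
theorem pureQuarticChain_isConfining_semigroup_kernel (hN : 0 < N) (hTL : 0 ≤ T_L) (hTR : 0 ≤ T_R)
    (t : ℝ≥0) :
    ((pureQuarticChain_isConfining hμ hγ).semigroup N T_L T_R hN hTL hTR).kernel t =
      (pureQuarticChain μ γ).transitionKernel N T_L T_R t :=
  pureQuarticChain_langevinKernel_eq_transitionKernel hμ hγ N T_L T_R t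

include hμ hγ in
/-- **CEHR (3.4) for the chain pipeline's transition kernels of the purely quartic chain**
(`μ > 0`, `γ ≥ 0`, `N ≥ 1`, `T_L > 0`, `T_R ≥ 0`, `0 < θ < 1/max(T_L, T_R)`):
`∫ e^{θH} dP_t(z, ·) ≤ e^{θγ(T_L+T_R)t} e^{θH(z)}` — the model-free pipeline's (3.4)
(`pureQuarticChain_lintegral_exp_mul_hamiltonian_kernel_le`) transported along the kernel
identification. [cite: CuneoEckmannHairerReyBellet2018, §3 eq. (3.4)] -/
theorem pureQuarticChain_lintegral_exp_mul_hamiltonian_transitionKernel_le (hN : 0 < N)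
    (hTL : 0 < T_L) (hTR : 0 ≤ T_R) {θ : ℝ} (hθ : 0 < θ) (hθ' : θ < 1 / max T_L T_R) (t : ℝ≥0)
    (z : PhaseSpace N) :
    ∫⁻ y, ENNReal.ofReal (Real.exp (θ * (pureQuarticChain μ γ).hamiltonian N y))
        ∂((pureQuarticChain μ γ).transitionKernel N T_L T_R t z) ≤
      ENNReal.ofReal (Real.exp (θ * γ * (T_L + T_R) * t) *
        Real.exp (θ * (pureQuarticChain μ γ).hamiltonian N z)) := by
  rw [← pureQuarticChain_langevinKernel_eq_transitionKernel hμ hγ N T_L T_R t]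
  exact pureQuarticChain_lintegral_exp_mul_hamiltonian_kernel_le hμ hγ hN hTL.le hTR hTL hθ hθ' t z

end Kernels

end Literature.MathematicalPhysics.KineticTheory.HeatConduction
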